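import Summits.MatrixMultiplication.MatrixMultiplication.Theorems.EdgePencilStarConvexity
import HarnessLib

/-!
# THE BLIND HEIGHT: `TetraFlat ⟺ TetraExcessZero ∧ BlindLow`, where `BlindLow` ("every blind spectral point
# has diamond rate `≤ 4`") is `HalfAlpha` restricted to the blind sub-spectrum — the exact residue of `ω(K₄) = 4`
# over the leaf, and the quantity that one base of tropical domination controls under star-convexity

Support kernel for `stmt-MatrixMultiplication-26697` (`TetraExcessZero : ω(K₄) ≤ ω(2,1,2) =: ψ`, route
`TetrahedronCarving`; cut of record `closes (TetraExcessZero) (TetraPlusTwo) : ω = 2`, UNCHANGED; lineage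
`decomp-mm-lens-6`, generation 45; sequel of `EdgePencilStarConvexity`). No item is added or changed; no
definition is introduced. Notation as there: `X₄(F)`, `[t]`, `W_n^{(e)} = sixTetra F n e`, `D_n = W_n^{(1)}`,
`T(K₄)_n = tetra F n`, `P_e`, `R̃`, `ψ = ω(2,1,2)`, `T = ω(K₄)`, `p_φ = log₂ φ[P_2]`, `d_φ = log₂ φ[D_2]`; the asides
`TetraFlat : ω(K₄) ≤ 4` (stmt-…-33477) and `HalfAlpha : 1/2 ≤ α` (stmt-…-26698) of the route file. A point
`φ ∈ X₄(F)` is BLIND at base `n` if `φ[W_n^{(2)}] = φ[D_n]` (`⟺ φ[P_2] = 1 ⟺ p_φ = 0`, base-free). The inline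
statement of this file:

  `BlindLow(n) : ∀ φ ∈ X₄(F), φ[W_n^{(2)}] = φ[D_n] → φ[D_n] ≤ n⁴`   (`⟺ ∀ φ, p_φ = 0 → d_φ ≤ 4`, `blindLow_iff_coord`;
  hence independent of the base `n ≥ 2`, `blindLow_iff_blindLow`).

§40 `BlindLow` IS THE RESIDUE OF FLATNESS OVER THE LEAF (`omegaTetra_le_four_iff_excessZero_and_blindLow`; by name
`tetraFlat_iff_tetraExcessZero_and_blindLow`):

  `TetraFlat ⟺ TetraExcessZero ∧ BlindLow`

— (⟹) `d_φ = p_φ + d_φ ≤ T ≤ 4` on blind points; (⟸) the leaf supplies a blind `T(K₄)_n`-MAXIMAL point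
(`EdgePencilBlindMaximal.excessZero_iff_exists_blind_maximal`), whose diamond value `n^{ω(K₄)}` is then `≤ n⁴`.
Compare the landed `TetraFlatSplit : TetraFlat ⟺ HalfAlpha ∧ TetraExcessZero`: `HalfAlpha ⟺ ∀ φ, d_φ ≤ 4`
bounds ALL points, `BlindLow` only the blind ones (`blindLow_of_halfAlpha`); under the leaf the two agree
(`blindLow_iff_halfAlpha_of_tetraExcessZero`). NEC: `ω = 2 ⟹ BlindLow` (`blindLow_of_matrixMultiplication`).

§41 WHAT TROPICAL DOMINATION CONTROLS (`blindLow_of_trop_two`): the star-convexity argument of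
`EdgePencilStarConvexity` is exactly `hSC ⟹ (TROP(n,2) ⟹ BlindLow(n))`, and its dichotomy factors as
`TROP(n,2) ⟹[hSC] BlindLow`, `BlindLow ∧ TetraExcessZero ⟺ TetraFlat` (`omegaTetra_le_four_of_excessZero_of_blindLow`).
So, modulo `hSC`, the blind height is the one spectral quantity through which one base of tropical domination
speaks to `ω(K₄)`; the registered stubs of `rung_and_chord` do not bound it (`EdgePencilThresholdCap`).

References: Strassen 1988, Thm. 3.8 [Strassen1988]; Zuiddam 2018, Thm. 2.12, Cor. 2.13 [Zuiddam2018];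
Christandl–Vrana–Zuiddam, arXiv:1609.07476, §1.2–1.3 [ChristandlVranaZuiddam2016]; Le Gall 2012, §1 [LeGall2012];
Alman–Li–Pratt 2026, Remark 3.2 [AlmanLiPratt2026]. No `sorry`, no new axiom, no instance, no notation, no definition.
-/

noncomputable section

set_option linter.dupNamespace false

open Finset Literature.Computability.AlgebraicComplexity
open Summit.MatrixMultiplication.MatrixMultiplication.Theorems.TetrahedronTensor
open Summit.MatrixMultiplication.MatrixMultiplication.Theorems.TetraDiagonal
open Summit.MatrixMultiplication.MatrixMultiplication.Theses.TetrahedronCarving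

namespace Summit.MatrixMultiplication.MatrixMultiplication.Theorems.EdgePencil

/-! ## §40 `BlindLow` in coordinates; the residue of flatness over the leaf -/

section BlindLow

variable (F : Type) [Field F]

/-- **Blind ⟺ `p_φ = 0`** (`n ≥ 2`): `φ[W_n^{(2)}] = φ[D_n] ⟺ φ[P_2] = 1 ⟺ log₂ φ[P_2] = 0`. [cite: Zuiddam2018, Thm. 2.12] -/
theorem blind_iff_coord_pair_eq_zero {n : ℕ} (hn : 2 ≤ n) {φ : DTensorClass F 4 → ℝ}
    (hφ : φ ∈ DTensorClass.asymptoticSpectrumDTensors F 2) :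
    φ (DTensorClass.mk (sixTetra F n 2)) = φ (DTensorClass.mk (sixTetra F n 1)) ↔
      Real.logb 2 (φ (DTensorClass.mk (fun i : Fin 4 → Fin 2 => (ind (i 0 = i 1) : F)))) = 0 := by
  rw [blind_iff_pair_eq_one F (by omega) hn hφ]
  have hP0 : 0 < φ (DTensorClass.mk (fun i : Fin 4 → Fin 2 => (ind (i 0 = i 1) : F))) :=
    one_pos.trans_le (one_le_spectrum_pair (by norm_num) hφ)
  constructor
  · intro h
    rw [h, Real.logb_one]
  · intro h
    rw [← Real.rpow_logb two_pos (by norm_num) hP0, h, Real.rpow_zero]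

/-- **`φ[D_n] ≤ n⁴ ⟺ d_φ ≤ 4`** (`n ≥ 2`). [cite: Strassen1988, Thm. 3.8] -/
theorem spectrum_diamond_le_pow_four_iff_coord {n : ℕ} (hn : 2 ≤ n) {φ : DTensorClass F 4 → ℝ}
    (hφ : φ ∈ DTensorClass.asymptoticSpectrumDTensors F 2) :
    φ (DTensorClass.mk (sixTetra F n 1)) ≤ (n : ℝ) ^ 4 ↔
      Real.logb 2 (φ (DTensorClass.mk (sixTetra F 2 1))) ≤ 4 := by
  have hn1' : (1 : ℝ) < n := by exact_mod_cast (show 1 < n by omega)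
  rw [spectrum_diamond_eq_rpow hφ (by omega : 1 ≤ n),
    show ((n : ℝ) ^ 4) = (n : ℝ) ^ (4 : ℝ) by
      rw [show (4 : ℝ) = ((4 : ℕ) : ℝ) by norm_num, Real.rpow_natCast],
    Real.rpow_le_rpow_left_iff hn1']

/-- **`BlindLow(n) ⟺ ∀ φ ∈ X₄(F), p_φ = 0 → d_φ ≤ 4`** (`n ≥ 2`). [cite: Zuiddam2018, Cor. 2.13] -/
theorem blindLow_iff_coord {n : ℕ} (hn : 2 ≤ n) :
    (∀ φ ∈ DTensorClass.asymptoticSpectrumDTensors F 2,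
      φ (DTensorClass.mk (sixTetra F n 2)) = φ (DTensorClass.mk (sixTetra F n 1)) →
        φ (DTensorClass.mk (sixTetra F n 1)) ≤ (n : ℝ) ^ 4) ↔
      ∀ φ ∈ DTensorClass.asymptoticSpectrumDTensors F 2,
        Real.logb 2 (φ (DTensorClass.mk (fun i : Fin 4 → Fin 2 => (ind (i 0 = i 1) : F)))) = 0 →
          Real.logb 2 (φ (DTensorClass.mk (sixTetra F 2 1))) ≤ 4 :=
  forall₂_congr fun _ hφ =>
    imp_congr (blind_iff_coord_pair_eq_zero F hn hφ) (spectrum_diamond_le_pow_four_iff_coord F hn hφ)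

/-- **`BlindLow` does not depend on the base.** [cite: Zuiddam2018, Cor. 2.13] -/
theorem blindLow_iff_blindLow {n m : ℕ} (hn : 2 ≤ n) (hm : 2 ≤ m) :
    (∀ φ ∈ DTensorClass.asymptoticSpectrumDTensors F 2,
      φ (DTensorClass.mk (sixTetra F n 2)) = φ (DTensorClass.mk (sixTetra F n 1)) →
        φ (DTensorClass.mk (sixTetra F n 1)) ≤ (n : ℝ) ^ 4) ↔
      ∀ φ ∈ DTensorClass.asymptoticSpectrumDTensors F 2,
        φ (DTensorClass.mk (sixTetra F m 2)) = φ (DTensorClass.mk (sixTetra F m 1)) →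
          φ (DTensorClass.mk (sixTetra F m 1)) ≤ (m : ℝ) ^ 4 := by
  rw [blindLow_iff_coord F hn, blindLow_iff_coord F hm]

/-- **`ω(K₄) ≤ 4 ⟹ BlindLow`**: on a blind point `d_φ = p_φ + d_φ ≤ ω(K₄) ≤ 4`. [cite: Strassen1988, Thm. 3.8] -/
theorem blindLow_of_omegaTetra_le_four (hT : omegaTetra F ≤ 4) {n : ℕ} (hn : 2 ≤ n) :
    ∀ φ ∈ DTensorClass.asymptoticSpectrumDTensors F 2,
      φ (DTensorClass.mk (sixTetra F n 2)) = φ (DTensorClass.mk (sixTetra F n 1)) →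
        φ (DTensorClass.mk (sixTetra F n 1)) ≤ (n : ℝ) ^ 4 := by
  rw [blindLow_iff_coord F hn]
  intro φ hφ hp
  have h := coord_sum_le_omegaTetra F hφ
  rw [hp, zero_add] at h
  exact h.trans hT

/-- **`ψ ≤ 4 ⟹ BlindLow`** (all points, blind or not: `φ[D_n] ≤ R̃[D_n] = n^ψ ≤ n⁴`). [cite: LeGall2012, §1] -/
theorem blindLow_of_omegaRect_le_four (hψ : omegaRect F 2 1 2 ≤ 4) {n : ℕ} (hn : 2 ≤ n) :
    ∀ φ ∈ DTensorClass.asymptoticSpectrumDTensors F 2,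
      φ (DTensorClass.mk (sixTetra F n 2)) = φ (DTensorClass.mk (sixTetra F n 1)) →
        φ (DTensorClass.mk (sixTetra F n 1)) ≤ (n : ℝ) ^ 4 := by
  rw [blindLow_iff_coord F hn]
  exact fun φ hφ _ => (coord_diamond_mem F hφ).2.trans hψ

/-- **THE LEAF ∧ `BlindLow` ⟹ `ω(K₄) ≤ 4`** (`n ≥ 2`): the leaf's blind `T(K₄)_n`-maximal point has diamond value
`n^{ω(K₄)} ≤ n⁴`. This is the second half of `EdgePencilStarConvexity.omegaTetra_le_four_of_excessZero_of_trop_two`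
with its first half (`TROP ⟹ BlindLow`, `blindLow_of_trop_two`) detached. [cite: Strassen1988, Thm. 3.8] -/
theorem omegaTetra_le_four_of_excessZero_of_blindLow {n : ℕ} (hn : 2 ≤ n) (hA : omegaTetra F ≤ omegaRect F 2 1 2)
    (hBL : ∀ φ ∈ DTensorClass.asymptoticSpectrumDTensors F 2,
      φ (DTensorClass.mk (sixTetra F n 2)) = φ (DTensorClass.mk (sixTetra F n 1)) →
        φ (DTensorClass.mk (sixTetra F n 1)) ≤ (n : ℝ) ^ 4) :
    omegaTetra F ≤ 4 := by
  obtain ⟨φ, hφ, hmax, hblind⟩ := (excessZero_iff_exists_blind_maximal F hn).1 hA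
  have hn1' : (1 : ℝ) < n := by exact_mod_cast (show 1 < n by omega)
  have hTn : φ (DTensorClass.mk (tetra F n)) = (n : ℝ) ^ omegaTetra F := by
    rw [hmax, rpow_omegaTetra_eq_asympRank F hn]
  have hW2le : φ (DTensorClass.mk (sixTetra F n 2)) ≤ φ (DTensorClass.mk (tetra F n)) := by
    have h := (DTensorClass.mem_asymptoticSpectrumDTensors_iff.1 hφ).mono
      (mk_sixTetra_mono (F := F) (n := n) hn)
    rwa [sixTetra_of_le le_rfl] at h
  have hbl2 : φ (DTensorClass.mk (sixTetra F n 2)) = φ (DTensorClass.mk (sixTetra F n 1)) :=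
    le_antisymm (by rw [← hblind]; exact hW2le) (spectrum_diamond_le_sixTetra (F := F) (by norm_num) hφ)
  have hD := hBL φ hφ hbl2
  rw [← hblind, hTn] at hD
  have h4 : (n : ℝ) ^ omegaTetra F ≤ (n : ℝ) ^ (4 : ℝ) := by
    rw [show (4 : ℝ) = ((4 : ℕ) : ℝ) by norm_num, Real.rpow_natCast]
    exact hD
  exact (Real.rpow_le_rpow_left_iff hn1').1 h4

/-- **`ω(K₄) ≤ 4 ⟺ leaf ∧ BlindLow`** (any field, any base `n ≥ 2`). [cite: Strassen1988, Thm. 3.8] -/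
theorem omegaTetra_le_four_iff_excessZero_and_blindLow {n : ℕ} (hn : 2 ≤ n) :
    omegaTetra F ≤ 4 ↔
      omegaTetra F ≤ omegaRect F 2 1 2 ∧
        ∀ φ ∈ DTensorClass.asymptoticSpectrumDTensors F 2,
          φ (DTensorClass.mk (sixTetra F n 2)) = φ (DTensorClass.mk (sixTetra F n 1)) →
            φ (DTensorClass.mk (sixTetra F n 1)) ≤ (n : ℝ) ^ 4 :=
  ⟨fun hT => ⟨hT.trans (four_le_omegaRect_two_one_two F), blindLow_of_omegaTetra_le_four F hT hn⟩,
    fun h => omegaTetra_le_four_of_excessZero_of_blindLow F hn h.1 h.2⟩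

end BlindLow

/-! ## §40′ By name over `ℂ`; NEC; what tropical domination controls -/

section ByName

/-- **`TetraFlat ⟺ TetraExcessZero ∧ BlindLow`** (any base `n ≥ 2`): `BlindLow` is the exact residue of the
aside `TetraFlat` over the attacked leaf. [cite: Strassen1988, Thm. 3.8] -/
theorem tetraFlat_iff_tetraExcessZero_and_blindLow {n : ℕ} (hn : 2 ≤ n) :
    TetraFlat ↔
      TetraExcessZero ∧
        ∀ φ ∈ DTensorClass.asymptoticSpectrumDTensors ℂ 2,
          φ (DTensorClass.mk (sixTetra ℂ n 2)) = φ (DTensorClass.mk (sixTetra ℂ n 1)) →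
            φ (DTensorClass.mk (sixTetra ℂ n 1)) ≤ (n : ℝ) ^ 4 :=
  omegaTetra_le_four_iff_excessZero_and_blindLow ℂ hn

/-- **`HalfAlpha ⟹ BlindLow`** (`HalfAlpha ⟺ R̃[D_n] ≤ n⁴` bounds every point). [cite: LeGall2012, §1] -/
theorem blindLow_of_halfAlpha (hH : HalfAlpha) {n : ℕ} (hn : 2 ≤ n) :
    ∀ φ ∈ DTensorClass.asymptoticSpectrumDTensors ℂ 2,
      φ (DTensorClass.mk (sixTetra ℂ n 2)) = φ (DTensorClass.mk (sixTetra ℂ n 1)) →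
        φ (DTensorClass.mk (sixTetra ℂ n 1)) ≤ (n : ℝ) ^ 4 :=
  fun _ hφ _ => (DTensorClass.le_asympRankOf hφ _).trans ((halfAlpha_iff_asympRank_diamond_le hn).1 hH)

/-- **`TetraFlat ⟹ BlindLow`.** [cite: ChristandlVranaZuiddam2016, §1.2] -/
theorem blindLow_of_tetraFlat (hT : TetraFlat) {n : ℕ} (hn : 2 ≤ n) :
    ∀ φ ∈ DTensorClass.asymptoticSpectrumDTensors ℂ 2,
      φ (DTensorClass.mk (sixTetra ℂ n 2)) = φ (DTensorClass.mk (sixTetra ℂ n 1)) →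
        φ (DTensorClass.mk (sixTetra ℂ n 1)) ≤ (n : ℝ) ^ 4 :=
  blindLow_of_omegaTetra_le_four ℂ hT hn

/-- **NEC**: `ω = 2 ⟹ BlindLow`. [cite: ChristandlVranaZuiddam2016, §1.2] -/
theorem blindLow_of_matrixMultiplication (hS : _root_.MatrixMultiplication) {n : ℕ} (hn : 2 ≤ n) :
    ∀ φ ∈ DTensorClass.asymptoticSpectrumDTensors ℂ 2,
      φ (DTensorClass.mk (sixTetra ℂ n 2)) = φ (DTensorClass.mk (sixTetra ℂ n 1)) →
        φ (DTensorClass.mk (sixTetra ℂ n 1)) ≤ (n : ℝ) ^ 4 :=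
  blindLow_of_tetraFlat (omegaTetra_le_four_of_matrixMultiplication hS) hn

/-- **Under the leaf, `BlindLow ⟺ HalfAlpha ⟺ TetraFlat`.** [cite: LeGall2012, §1] -/
theorem blindLow_iff_halfAlpha_of_tetraExcessZero (hA : TetraExcessZero) {n : ℕ} (hn : 2 ≤ n) :
    (∀ φ ∈ DTensorClass.asymptoticSpectrumDTensors ℂ 2,
      φ (DTensorClass.mk (sixTetra ℂ n 2)) = φ (DTensorClass.mk (sixTetra ℂ n 1)) →
        φ (DTensorClass.mk (sixTetra ℂ n 1)) ≤ (n : ℝ) ^ 4) ↔ HalfAlpha :=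
  ⟨fun hBL => half_le_dualExponentAlpha_of_tetraFlat
      ((tetraFlat_iff_tetraExcessZero_and_blindLow hn).2 ⟨hA, hBL⟩),
    fun hH => blindLow_of_halfAlpha hH hn⟩

variable (F : Type) [Field F]

/-- **`hSC ⟹ (TROP(n,2) ⟹ BlindLow(n))`** (`n ≥ 2`): the content of the star-convexity interpolation, isolated —
`EdgePencilStarConvexity.spectrum_diamond_le_of_trop_two_of_blind` quantified. With
`omegaTetra_le_four_iff_excessZero_and_blindLow` this recomposes the dichotomy
`TROP(n,2) ∧ leaf ⟹[hSC] ω(K₄) ≤ 4`. [cite: AlmanLiPratt2026, Remark 3.2] -/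
theorem blindLow_of_trop_two
    (hSC : ∀ φ ∈ DTensorClass.asymptoticSpectrumDTensors F 2, ∀ l : ℝ, 0 < l → l < 1 →
      ∃ φ' ∈ DTensorClass.asymptoticSpectrumDTensors F 2, ∀ m e : ℕ, 1 ≤ e → e ≤ m →
        φ' (DTensorClass.mk (sixTetra F m e)) =
          ((e : ℝ) * (m : ℝ) ^ 2) ^ l * (φ (DTensorClass.mk (sixTetra F m e))) ^ (1 - l))
    {n : ℕ} (hn : 2 ≤ n)
    (hT : ∀ φ ∈ DTensorClass.asymptoticSpectrumDTensors F 2,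
      φ (DTensorClass.mk (sixTetra F n 2)) ≤ max (φ (DTensorClass.mk (sixTetra F n 1))) ((n : ℝ) ^ 4)) :
    ∀ φ ∈ DTensorClass.asymptoticSpectrumDTensors F 2,
      φ (DTensorClass.mk (sixTetra F n 2)) = φ (DTensorClass.mk (sixTetra F n 1)) →
        φ (DTensorClass.mk (sixTetra F n 1)) ≤ (n : ℝ) ^ 4 :=
  fun _ hφ hbl => spectrum_diamond_le_of_trop_two_of_blind F hSC hn hT hφ hbl

/-- **The blind height is at least `4`**: some blind point of `X₄(F)` has `d_φ ≥ 4`… in fact the leaf is not needed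
for the lower bound `ψ ≥ 4`, but a BLIND witness of height exactly `ω(K₄)` exists iff the leaf holds
(`EdgePencilExponentConstancy.tetraExcessZero_iff_coord`); unconditionally, every `T(K₄)`-maximal point has
`p_φ + d_φ = ω(K₄) ≥ 4`. Recorded: `BlindLow ⟹ every blind point has p_φ + d_φ ≤ 4`, so under `BlindLow` a blind
point is `T(K₄)`-maximal only if `ω(K₄) = 4`. [cite: ChristandlVranaZuiddam2016, §1.2] -/
theorem coord_sum_le_four_of_blindLow_of_blind {n : ℕ} (hn : 2 ≤ n)
    (hBL : ∀ φ ∈ DTensorClass.asymptoticSpectrumDTensors F 2,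
      φ (DTensorClass.mk (sixTetra F n 2)) = φ (DTensorClass.mk (sixTetra F n 1)) →
        φ (DTensorClass.mk (sixTetra F n 1)) ≤ (n : ℝ) ^ 4)
    {φ : DTensorClass F 4 → ℝ} (hφ : φ ∈ DTensorClass.asymptoticSpectrumDTensors F 2)
    (hp : Real.logb 2 (φ (DTensorClass.mk (fun i : Fin 4 → Fin 2 => (ind (i 0 = i 1) : F)))) = 0) :
    Real.logb 2 (φ (DTensorClass.mk (fun i : Fin 4 → Fin 2 => (ind (i 0 = i 1) : F)))) +
        Real.logb 2 (φ (DTensorClass.mk (sixTetra F 2 1))) ≤ 4 := by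
  rw [hp, zero_add]
  exact (blindLow_iff_coord F hn).1 hBL φ hφ hp

end ByName

end Summit.MatrixMultiplication.MatrixMultiplication.Theorems.EdgePencil

end
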